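import Literature.AlgebraicGeometry.Resolution.ExceptionalDivisorProjCharts
import Literature.AlgebraicGeometry.Resolution.AffineBlowupCartier
import Literature.AlgebraicGeometry.Motives.ProjBaseChangeAny
import Mathlib.AlgebraicGeometry.ProjectiveSpectrum.Functor
import Mathlib.AlgebraicGeometry.IdealSheaf.Functorial
import Mathlib.AlgebraicGeometry.Morphisms.ClosedImmersion
import HarnessLib

/-!
# The exceptional divisor of the blowing up of a quasi-regular centre is a projective space over the centre

Topic: `Literature/AlgebraicGeometry/Resolution`. Theorem-only file (sorry-free). The AFFINE,
model form of Hartshorne II Thm. 8.24 (b) / Liu Thm. 8.1.19 (b) ("`E := π⁻¹(Y)` is a projective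
bundle `ℙ(C_{Y/X})` of rank `codim(Y, X) − 1` over `Y`", for a quasi-regular centre, where
`C_{Y/X} = 𝓘/𝓘²` is free): let `x = (x₀, …, x_r)` be a **quasi-regular** sequence in a ring `L`,
`I = (x)`, `π : Bl = Proj L[It] → Spec L` the blowing up (`AffineBlowup.lean`), and let
`j : T ↪ Spec L` be ANY closed immersion with ideal `I` (`j.ker` = the ideal sheaf of `I`). The
exceptional divisor `E = Bl ×_{Spec L} T`, mapped to `ℙʳ_L = Proj L[T₀, …, T_r]` through the
closed immersion `Bl ↪ ℙʳ_L` of the graded presentation `T_j ↦ x_j t`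
(`ExceptionalDivisorProjCharts.lean`, Mathlib `Proj.map`), together with its projection to `T`,
is the FIBRE PRODUCT `T ×_{Spec L} ℙʳ_L = ℙʳ_T`:

* `isPullback_exceptional_projectiveSpace` — `IsPullback (pr₁ ≫ Proj.map) pr₂ (ℙʳ_L → Spec L) j`;
* `isPullback_exceptional_projectiveSpace_over` — composed with `ℙʳ_L = ℙʳ_k ×_k Spec L`
  (`Motives/ProjBaseChangeAny`): `E` is `T ×_k ℙʳ_k` over any base ring `k → L`.

Proof: a square over `ℙʳ_L` is cartesian if it is so over the standard charts `D₊(T_i)` (Mathlib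
`Scheme.isPullback_of_openCover`). Over `D₊(T_i) = Spec (L[T]_{T_i})₀` the exceptional divisor is
`Spec ((L[It]_{(x_i t)})₀ ⧸ I)` (base change of `j` along the chart `D₊(x_i t) → Spec L` of the
blowing up, `isPullback_specMap_quotient_centre`, pasted with Mathlib's cartesian square
`Proj.awayι_comp_map`), and the resulting affine square over `Spec L` is cartesian by the
kernel criterion for closed immersions (Mathlib `isPullback_of_isClosedImmersion`): the kernel of
`(L[T]_{T_i})₀ → (L[It]_{(x_i t)})₀ ⧸ I` is exactly `I · (L[T]_{T_i})₀`
(`ker_quotient_comp_awayMap_reesPresentation`, quasi-regularity).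

## References

* R. Hartshorne, *Algebraic Geometry*, GTM 52 (1977), II Thm. 8.24 (b). [Hartshorne1977]
* Q. Liu, *Algebraic Geometry and Arithmetic Curves* (2002), Thm. 8.1.19 (b). [Liu2002]
* W. Fulton, *Intersection Theory*, 2nd ed. (1998), App. B.6.9. [Fulton1998]
-/

noncomputable section

open CategoryTheory CategoryTheory.Limits AlgebraicGeometry HomogeneousLocalization MvPolynomial
open Literature.AlgebraicGeometry.Motives Literature.AlgebraicGeometry.Motives.ProjBaseChangeRing

namespace Literature.AlgebraicGeometry.Resolution

universe u

attribute [local instance] MvPolynomial.gradedAlgebra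
  Literature.AlgebraicGeometry.Motives.ProjBaseChange.algebraBase

/-! ## Ideal sheaves on `Spec`: kernels of `Spec` of ring maps -/

section SpecKer

variable {A B : Type u} [CommRing A] [CommRing B]

/-- **The kernel of `Spec B → Spec A` is the ideal sheaf of `ker (A → B)`** (both read through
`Γ(Spec A, ⊤) ≅ A`; `affineBlowup.idealSheaf J` is the ideal sheaf of `J ⊆ A` on `Spec A`).
-- adapted from `Literature.AlgebraicGeometry.Resolution.ker_specMap_quotient_mk`
[folklore] -/
theorem ker_specMap_eq_idealSheaf (θ : A →+* B) :
    (Spec.map (CommRingCat.ofHom θ)).ker = affineBlowup.idealSheaf (RingHom.ker θ) := by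
  rw [Scheme.ker_of_isAffine]
  unfold affineBlowup.idealSheaf
  congr 1
  have hnat := Scheme.ΓSpecIso_inv_naturality (CommRingCat.ofHom θ)
  have happ : (Spec.map (CommRingCat.ofHom θ)).appTop =
      (Scheme.ΓSpecIso (.of A)).hom ≫ (CommRingCat.ofHom θ ≫ (Scheme.ΓSpecIso (.of B)).inv) :=
    (Iso.inv_comp_eq _).mp hnat.symm
  rw [happ]
  ext f
  simp only [RingHom.mem_ker, CommRingCat.hom_comp, RingHom.coe_comp, Function.comp_apply]
  have hinj : Function.Injective (Scheme.ΓSpecIso (.of B)).inv.hom :=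
    (Scheme.ΓSpecIso (.of B)).commRingCatIsoToRingEquiv.symm.injective
  have hsurj : Function.Surjective (Scheme.ΓSpecIso (.of A)).inv.hom :=
    (Scheme.ΓSpecIso (.of A)).commRingCatIsoToRingEquiv.symm.surjective
  rw [← map_zero (Scheme.ΓSpecIso (.of B)).inv.hom, hinj.eq_iff, CommRingCat.hom_ofHom,
    ← RingHom.mem_ker, Ideal.mem_map_iff_of_surjective _ hsurj]
  constructor
  · intro h
    exact ⟨_, h, by rw [← CommRingCat.comp_apply, Iso.hom_inv_id]; rfl⟩
  · rintro ⟨g, hg, rfl⟩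
    rwa [← CommRingCat.comp_apply, Iso.inv_hom_id, CommRingCat.id_apply]

/-- The ideal sheaf of `J` pulls back along `Spec B → Spec A` to the ideal sheaf of `J · B`.
[folklore] -/
theorem comap_idealSheaf_specMap (φ : A →+* B) (J : Ideal A) :
    (affineBlowup.idealSheaf J).comap (Spec.map (CommRingCat.ofHom φ)) =
      affineBlowup.idealSheaf (J.map φ) :=
  comap_ofIdealTop_SpecMap φ J

/-- `idealSheaf` is monotone. [folklore] -/
theorem idealSheaf_mono {J J' : Ideal A} (h : J ≤ J') :
    affineBlowup.idealSheaf J ≤ affineBlowup.idealSheaf J' :=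
  Scheme.IdealSheafData.le_of_isAffine (by
    unfold affineBlowup.idealSheaf
    rw [ideal_ofIdealTop_top, ideal_ofIdealTop_top]
    exact Ideal.map_mono h)

end SpecKer

/-! ## Base change of the centre along a ring map -/

section Centre

variable {L : Type u} [CommRing L] (I : Ideal L) {T : Scheme.{u}} (j : T ⟶ Spec (.of L))
  [IsClosedImmersion j] (hj : j.ker = affineBlowup.idealSheaf I)
  {B : Type u} [CommRing B] (ψ : L →+* B)

include hj in
omit [IsClosedImmersion j] in
/-- `Spec (B ⧸ I B) → Spec B → Spec L` kills the ideal of the centre `T = V(I)`. [folklore] -/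
theorem ker_le_ker_specMap_quotient :
    j.ker ≤ (Spec.map (CommRingCat.ofHom (Ideal.Quotient.mk (I.map ψ))) ≫
      Spec.map (CommRingCat.ofHom ψ)).ker := by
  rw [hj, ← Spec.map_comp, ← CommRingCat.ofHom_comp, ker_specMap_eq_idealSheaf]
  refine idealSheaf_mono fun a ha => ?_
  rw [RingHom.mem_ker, RingHom.comp_apply, Ideal.Quotient.eq_zero_iff_mem]
  exact Ideal.mem_map_of_mem _ ha

/-- The morphism `Spec (B ⧸ I B) → T` over `Spec B → Spec L`, for a closed immersion
`j : T ↪ Spec L` with ideal `I` (universal property of closed immersions). [folklore] -/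
def centreLift : Spec (.of (B ⧸ I.map ψ)) ⟶ T :=
  IsClosedImmersion.lift j _ (ker_le_ker_specMap_quotient I j hj ψ)

/-- `centreLift` lies over `Spec B → Spec L`. [folklore] -/
@[reassoc]
theorem centreLift_comp :
    centreLift I j hj ψ ≫ j = Spec.map (CommRingCat.ofHom (Ideal.Quotient.mk (I.map ψ))) ≫
      Spec.map (CommRingCat.ofHom ψ) :=
  IsClosedImmersion.lift_fac _ _ _

/-- **Base change of the centre**: for a closed immersion `j : T ↪ Spec L` with ideal `I` and
any ring map `ψ : L → B`, `Spec (B ⧸ I B) = Spec B ×_{Spec L} T` (kernel criterion for closed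
immersions). [folklore] -/
theorem isPullback_specMap_quotient_centre :
    IsPullback (Spec.map (CommRingCat.ofHom (Ideal.Quotient.mk (I.map ψ)))) (centreLift I j hj ψ)
      (Spec.map (CommRingCat.ofHom ψ)) j := by
  haveI := IsClosedImmersion.spec_of_surjective
    (CommRingCat.ofHom (Ideal.Quotient.mk (I.map ψ))) Ideal.Quotient.mk_surjective
  refine isPullback_of_isClosedImmersion _ _ _ _ (centreLift_comp I j hj ψ).symm ?_
  rw [hj, comap_idealSheaf_specMap, ker_specMap_eq_idealSheaf, Ideal.mk_ker]

end Centre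

/-! ## The exceptional divisor is `ℙʳ` over the centre -/

section Exceptional

variable {L : Type u} [CommRing L] {r : ℕ} (x : Fin (r + 1) → L)

local notation3 "𝓘" => Ideal.span (Set.range x)
local notation3 "ℛ" => reesGrading (Ideal.span (Set.range x))
local notation3 "𝒜" => MvPolynomial.homogeneousSubmodule (Fin (r + 1)) L

variable {T : Scheme.{u}} (j : T ⟶ Spec (.of L)) [IsClosedImmersion j]

-- NB: the hypothesis `hj : j.ker = affineBlowup.idealSheaf 𝓘` is an explicit argument of each
-- statement below (a `variable` binder mentioning the local notation `𝓘` does not elaborate).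

/-- The chart `D₊(s) = Spec (L[It]_s)₀ → Bl → Spec L` is `Spec` of `a ↦ a/1`. [folklore] -/
theorem awayι_comp_π (s : reesAlgebra 𝓘) {d : ℕ} (hs : s ∈ ℛ d) (hd : 0 < d) :
    Proj.awayι ℛ s hs hd ≫ affineBlowup.π 𝓘 = Spec.map (CommRingCat.ofHom (reesAwayBase x s)) := by
  rw [affineBlowup.π, Proj.awayι_toSpecZero_assoc, ← Spec.map_comp]
  rfl

/-- **The exceptional divisor over a chart of the blowing up**: with `E = Bl ×_{Spec L} T`, the
square `Spec ((L[It]_s)₀ ⧸ I) → D₊(s)`, `→ E`, `D₊(s) ↪ Bl`, `pr₁ : E → Bl` is cartesian (paste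
`isPullback_specMap_quotient_centre` under the defining square of `E`). [folklore] -/
theorem isPullback_exceptional_chart (hj : j.ker = affineBlowup.idealSheaf 𝓘) (s : reesAlgebra 𝓘)
    {d : ℕ} (hs : s ∈ ℛ d) (hd : 0 < d) :
    IsPullback (Spec.map (CommRingCat.ofHom (Ideal.Quotient.mk (Ideal.map (reesAwayBase x s) 𝓘))))
      ((IsPullback.of_hasPullback (affineBlowup.π 𝓘) j).lift
        (Spec.map (CommRingCat.ofHom (Ideal.Quotient.mk (Ideal.map (reesAwayBase x s) 𝓘))) ≫
          Proj.awayι ℛ s hs hd)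
        (centreLift 𝓘 j hj (reesAwayBase x s))
        (by rw [Category.assoc, awayι_comp_π, centreLift_comp]))
      (Proj.awayι ℛ s hs hd) (pullback.fst (affineBlowup.π 𝓘) j) := by
  have hsq := isPullback_specMap_quotient_centre 𝓘 j hj (reesAwayBase x s)
  rw [← awayι_comp_π x s hs hd] at hsq
  exact IsPullback.of_bot' hsq (IsPullback.of_hasPullback (affineBlowup.π 𝓘) j)

/-- Mathlib's cartesian chart square of `Proj.map` for the presentation `T_j ↦ x_j t`:
`D₊(x_i t) = D₊(T_i) ×_{ℙʳ_L} Bl`. [folklore] -/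
theorem isPullback_awayι_projMap (i : Fin (r + 1)) :
    IsPullback (Spec.map (CommRingCat.ofHom (Away.map (reesPresentation x) (X i))))
      (Proj.awayι ℛ (reesPresentation x (X i)) (reesPresentation_X_mem x i) one_pos)
      (Proj.awayι 𝒜 (X i) (ProjectiveSpace.X_mem i) one_pos)
      (Proj.map (reesPresentation x) (irrelevant_le_map_reesPresentation x)) :=
  IsOpenImmersion.isPullback _ _ _ _ (Proj.awayι_comp_map _ _ one_pos _ (ProjectiveSpace.X_mem i))
    (by rw [Proj.opensRange_awayι, Proj.opensRange_awayι, Proj.map_preimage_basicOpen])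

/-- The `L`-algebra structure of `(L[T]_{T_i})₀` followed by `Away.map` of the presentation is the
structure map of `(L[It]_{(x_i t)})₀`. [folklore] -/
theorem awayMap_comp_algebraMap (i : Fin (r + 1)) :
    (Away.map (reesPresentation x) (X i)).comp (algebraMap L (Away 𝒜 (X i))) =
      reesAwayBase x (reesPresentation x (X i)) :=
  RingHom.ext fun a => awayMap_reesPresentation_algebraMap x (X i) a

/-- **The affine exceptional chart square is cartesian**: for `x` quasi-regular,
`Spec ((L[It]_{(x_i t)})₀ ⧸ I) = D₊(T_i) ×_{Spec L} T` with `D₊(T_i) = Spec (L[T]_{T_i})₀ ⊆ ℙʳ_L`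
(kernel criterion: `ker ((L[T]_{T_i})₀ → (L[It]_{(x_i t)})₀ ⧸ I) = I · (L[T]_{T_i})₀`,
`ker_quotient_comp_awayMap_reesPresentation`). [cite: Liu2002, Thm. 8.1.19 (b)] -/
theorem isPullback_exceptional_affineChart (hj : j.ker = affineBlowup.idealSheaf 𝓘)
    (hx : IsQuasiRegular x) (i : Fin (r + 1)) :
    IsPullback
      (Spec.map (CommRingCat.ofHom (Ideal.Quotient.mk
          (Ideal.map (reesAwayBase x (reesPresentation x (X i))) 𝓘))) ≫
        Spec.map (CommRingCat.ofHom (Away.map (reesPresentation x) (X i))))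
      (centreLift 𝓘 j hj (reesAwayBase x (reesPresentation x (X i))))
      (Spec.map (CommRingCat.ofHom (algebraMap L (Away 𝒜 (X i))))) j := by
  have hcomp : Spec.map (CommRingCat.ofHom (Ideal.Quotient.mk
        (Ideal.map (reesAwayBase x (reesPresentation x (X i))) 𝓘))) ≫
      Spec.map (CommRingCat.ofHom (Away.map (reesPresentation x) (X i))) =
      Spec.map (CommRingCat.ofHom ((Ideal.Quotient.mk
        (Ideal.map (reesAwayBase x (reesPresentation x (X i))) 𝓘)).comp
          (Away.map (reesPresentation x) (X i)))) := by
    rw [CommRingCat.ofHom_comp, Spec.map_comp]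
  haveI : IsClosedImmersion (Spec.map (CommRingCat.ofHom (Ideal.Quotient.mk
        (Ideal.map (reesAwayBase x (reesPresentation x (X i))) 𝓘))) ≫
      Spec.map (CommRingCat.ofHom (Away.map (reesPresentation x) (X i)))) := by
    rw [hcomp]
    exact IsClosedImmersion.spec_of_surjective _
      (quotient_comp_awayMap_reesPresentation_surjective x i)
  refine isPullback_of_isClosedImmersion _ _ _ _ ?_ ?_
  · rw [centreLift_comp, hcomp, ← Spec.map_comp, ← Spec.map_comp, ← CommRingCat.ofHom_comp,
      ← CommRingCat.ofHom_comp, RingHom.comp_assoc, awayMap_comp_algebraMap]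
  · rw [hj, comap_idealSheaf_specMap, hcomp, ker_specMap_eq_idealSheaf,
      ker_quotient_comp_awayMap_reesPresentation x i hx]

/-- **The exceptional divisor of the blowing up of a quasi-regular centre is `ℙʳ` over the
centre** (Hartshorne II Thm. 8.24 (b); Liu Thm. 8.1.19 (b): `E ≅ ℙ(𝓘/𝓘²)`; Fulton B.6.9), affine
model form: for a quasi-regular sequence `x = (x₀, …, x_r)` in `L`, `I = (x)`, the blowing up
`π : Bl = Proj L[It] → Spec L` and ANY closed immersion `j : T ↪ Spec L` with ideal `I`, the
exceptional divisor `E = Bl ×_{Spec L} T` with its morphism to `ℙʳ_L = Proj L[T₀, …, T_r]`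
(through `Bl ↪ ℙʳ_L`, `T_j ↦ x_j t`) and its projection to `T` is the fibre product
`ℙʳ_L ×_{Spec L} T = ℙʳ_T`. [cite: Hartshorne1977, II Thm. 8.24 (b)] [cite: Liu2002, Thm. 8.1.19 (b)] -/
theorem isPullback_exceptional_projectiveSpace (hj : j.ker = affineBlowup.idealSheaf 𝓘)
    (hx : IsQuasiRegular x) :
    IsPullback
      (pullback.fst (affineBlowup.π 𝓘) j ≫
        Proj.map (reesPresentation x) (irrelevant_le_map_reesPresentation x))
      (pullback.snd (affineBlowup.π 𝓘) j) (projToSpec (Fin (r + 1)) L) j := by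
  refine Scheme.isPullback_of_openCover _ _ _ _
    (Proj.affineOpenCoverOfIrrelevantLESpan 𝒜
      (fun s : Fin (r + 1) => (X s : MvPolynomial (Fin (r + 1)) L)) (m := fun _ => 1)
      (fun s => ProjectiveSpace.X_mem s) (fun _ => one_pos) (irrelevant_le_span_X L)).openCover
    fun i' ↦ ?_
  obtain ⟨i, rfl⟩ : ∃ i : Fin (r + 1), i = i' := ⟨i', rfl⟩
  have H := (isPullback_exceptional_chart x j hj (reesPresentation x (X i))
    (reesPresentation_X_mem x i) one_pos).paste_horiz (isPullback_awayι_projMap x i)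
  have hA := isPullback_exceptional_affineChart x j hj hx i
  refine hA.of_iso H.flip.isoPullback (Iso.refl _) (Iso.refl _) (Iso.refl _) ?_ ?_ ?_ ?_
  · exact (Category.comp_id _).trans H.flip.isoPullback_hom_snd.symm
  · exact (Category.comp_id _).trans ((IsPullback.lift_snd _ _ _ _).symm.trans
      ((congrArg (· ≫ pullback.snd (affineBlowup.π 𝓘) j) H.flip.isoPullback_hom_fst.symm).trans
        (Category.assoc _ _ _)))
  · exact (Category.comp_id _).trans
      ((awayι_projToSpec (Fin (r + 1)) (ProjectiveSpace.X_mem i) one_pos).symm.trans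
        (Category.id_comp _).symm)
  · simp

/-- **The exceptional divisor is `T ×_k ℙʳ_k` over any base ring `k → L`**: composing with the
cartesian square `ℙʳ_L = ℙʳ_k ×_{Spec k} Spec L` (`Motives/ProjBaseChangeAny`), the exceptional
divisor `E = Bl ×_{Spec L} T` with its morphism to `ℙʳ_k` and its projection to `T` is the
fibre product of `ℙʳ_k → Spec k` and `T → Spec L → Spec k`.
[cite: Hartshorne1977, II Thm. 8.24 (b)] [cite: Liu2002, Thm. 8.1.19 (b)] -/
theorem isPullback_exceptional_projectiveSpace_over (hj : j.ker = affineBlowup.idealSheaf 𝓘)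
    (hx : IsQuasiRegular x) (k : Type u) [CommRing k] [Algebra k L] :
    IsPullback
      (pullback.fst (affineBlowup.π 𝓘) j ≫
        Proj.map (reesPresentation x) (irrelevant_le_map_reesPresentation x) ≫
        Proj.map (mapGraded k L (Fin (r + 1))) (irrelevant_le_map k L (Fin (r + 1))))
      (pullback.snd (affineBlowup.π 𝓘) j) (projToSpec (Fin (r + 1)) k)
      (j ≫ Spec.map (CommRingCat.ofHom (algebraMap k L))) := by
  have := (isPullback_exceptional_projectiveSpace x j hj hx).paste_horiz (isPullback_projMap' k L)
  simpa only [Category.assoc] using this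

end Exceptional

end Literature.AlgebraicGeometry.Resolution

end
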